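import Mathlib
import Summits.NavierStokesRegularity.NavierStokesRegularity.Theorems.ThreadingFluxHorizonTowerFiniteTowerIsolation
import HarnessLib

/-!
# Crux `PoloidalLiouville` (stmt-NavierStokesRegularity-1222), crux idea «horizon-threading-tower» (ns-idea-15):
# FINITE TOWERS AT ORDER ONE — THE ISOLATION LEMMA INSIDE A PARITY CLASS

Support file (`--supports stmt-NavierStokesRegularity-1222`, helper; cell `ns-wall-extremal`, width hand ns-wall-eng-3 g4; 0 kit).

`finiteTower_chartT_detP_eq_zero_of_class`: the parity-aware form of the isolation lemma `finiteTower_chartT_detP_eq_zero`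
(`…FiniteTowerIsolation`, p703096).  Since the order-one identity splits into the two parity classes of `j + k`
(`finiteTower_parity_split`, p695631), the competitors of a pair `(j₀, k₀)` need only be excluded INSIDE ITS CLASS: if every other pair
`{j, k} ⊂ K` (`j ≠ k`) with `j + k ≥ j₀ + k₀` and `j + k ≡ j₀ + k₀ (mod 2)` has `detP P_j P_k = 0`, then `chartT (detP P_{j₀} P_{k₀}) = 0`,
i.e. the weighted Wronskian law `j₀·f·g′ = k₀·g·f′` holds for the charts.  Consumed by THM C (`…FiniteTowerThirdShell`): the largest
degree of the parity opposite to the top degree is always isolated in its class.  (Same proof as p703096 with the class condition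
threaded through; kept as a separate file because the isolation file is at its size cap.)

HONEST LABEL: algebra about one crux idea's typed objects; no sketch Prop closed; `HorizonTowerZonality`, `PoloidalLiouville` (1222)
OPEN; NS regularity NOT proved.  [folklore]
-/

-- the summit and its single sub-problem share the name (CONVENTIONS §1)
set_option linter.dupNamespace false

noncomputable section

open MvPolynomial Complex
open scoped Polynomial RealInnerProductSpace
open Literature.Analysis.FluidPDE (cross)
open Literature.Geometry.DiscreteGeometry (inner_fin3 norm_sq_fin3)

namespace Summit.NavierStokesRegularity.NavierStokesRegularity.Theorems.PoloidalLiouville.HorizonTower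

section FiniteTowerClass

variable (K : Finset ℕ) (H : ℕ → E3 → ℝ)

/-- ★ **THE ISOLATION LEMMA, PARITY-AWARE FORM** (appended by ns-wall-eng-3 g4 for THM C): the competitors of the pair `(j₀, k₀)` need
only be excluded INSIDE ITS PARITY CLASS — every other pair `{j, k} ⊂ K` (`j ≠ k`) with `j + k ≥ j₀ + k₀` AND `j + k ≡ j₀ + k₀ (mod 2)`
has `detP P_j P_k = 0` ⇒ `chartT (detP P_{j₀} P_{k₀}) = 0` (the two parity classes never mix, `finiteTower_parity_split`). [folklore] -/
theorem finiteTower_chartT_detP_eq_zero_of_class (hK : ∀ l ∈ K, 1 ≤ l) (hH : ∀ l ∈ K, ContDiff ℝ (⊤ : ℕ∞) (H l))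
    (hhom : ∀ l ∈ K, ∀ (c : ℝ) (y : E3), H l (c • y) = c ^ l * H l y)
    (hharm : ∀ l ∈ K, ∀ y, Laplacian.laplacian (H l) y = 0)
    (hL1 : ∀ x : E3, x ≠ 0 → horizonL1 (fun z => ∑ l ∈ K, horizonProfile l (H l) 0 z) 0 x = 0)
    (P : ℕ → MvPolynomial (Fin 3) ℝ) (hP : ∀ l ∈ K, ∀ y, H l y = Zonal.evalE (P l) y)
    {j₀ k₀ : ℕ} (hj₀ : j₀ ∈ K) (hk₀ : k₀ ∈ K) (hjk : j₀ ≠ k₀)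
    (hiso : ∀ j ∈ K, ∀ k ∈ K, j ≠ k → j₀ + k₀ ≤ j + k → (j + k) % 2 = (j₀ + k₀) % 2 → ¬(j = j₀ ∧ k = k₀) →
      ¬(j = k₀ ∧ k = j₀) → Zonal.detP (P j) (P k) = 0) :
    Zonal.chartT (map (algebraMap ℝ ℂ) (Zonal.detP (P j₀) (P k₀))) = 0 := by
  classical
  set N : ℕ := j₀ + k₀ with hN
  set ρ : MvPolynomial (Fin 3) ℝ := X 0 ^ 2 + X 1 ^ 2 + X 2 ^ 2 with hρ
  -- the bracket functions are the bracket polynomials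
  have hB : ∀ j ∈ K, ∀ k ∈ K, ∀ x : E3,
      ⟪x, cross (gradient (H j) x) (gradient (H k) x)⟫ = Zonal.evalE (Zonal.detP (P j) (P k)) x := by
    intro j hj k hk x
    rw [show H j = Zonal.evalE (P j) from funext (hP j hj), show H k = Zonal.evalE (P k) from funext (hP k hk)]
    exact LoopLaw.loopBracket_evalE (P j) (P k) x
  -- pairs strictly above `N` in the class have vanishing bracket
  have habove : ∀ j ∈ K, ∀ k ∈ K, N < j + k → (j + k) % 2 = N % 2 → Zonal.detP (P j) (P k) = 0 := by
    intro j hj k hk hlt hpar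
    by_cases hjk' : j = k
    · rw [hjk', Zonal.detP_self']
    · exact hiso j hj k hk hjk' hlt.le hpar (by rintro ⟨rfl, rfl⟩; omega) (by rintro ⟨rfl, rfl⟩; omega)
  -- the homogenised class polynomial
  set Q : MvPolynomial (Fin 3) ℝ := ∑ j ∈ K, ∑ k ∈ K,
    if j + k ≤ N ∧ (j + k) % 2 = N % 2 then C ((j : ℝ) * (j + 1) - (k : ℝ) * (k + 1)) * (ρ ^ ((N - (j + k)) / 2) * Zonal.detP (P j) (P k)) else 0
    with hQ
  -- (1) it vanishes off the centre
  have hQx : ∀ x : E3, x ≠ 0 → Zonal.evalE Q x = 0 := by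
    intro x hx
    obtain ⟨hE, hO⟩ := finiteTower_parity_split K H hK hH hhom hharm hL1 hx
    -- the class sum of the parity of `N`
    have hS : ∑ j ∈ K, ∑ k ∈ K, (if (j + k) % 2 = N % 2 then
        (((j : ℝ) * (j + 1) - (k : ℝ) * (k + 1)) * (‖x‖ ^ 2) ^ (-(j : ℝ) / 2) * (‖x‖ ^ 2) ^ (-(k : ℝ) / 2)
          * ⟪x, cross (gradient (H j) x) (gradient (H k) x)⟫) else 0) = 0 := by
      rcases Nat.even_or_odd N with hNe | hNo
      · have hN0 : N % 2 = 0 := Nat.even_iff.mp hNe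
        refine Eq.trans (Finset.sum_congr rfl fun j _ => Finset.sum_congr rfl fun k _ => ?_) hE
        rw [hN0]
        by_cases hjk2 : Even (j + k)
        · rw [if_pos (Nat.even_iff.mp hjk2), if_pos hjk2]
        · rw [if_neg (by rw [Nat.even_iff] at hjk2; exact hjk2), if_neg hjk2]
      · have hN1 : N % 2 = 1 := Nat.odd_iff.mp hNo
        refine Eq.trans (Finset.sum_congr rfl fun j _ => Finset.sum_congr rfl fun k _ => ?_) hO
        rw [hN1]
        by_cases hjk2 : Even (j + k)
        · rw [if_neg (by rw [Nat.even_iff.mp hjk2]; decide), if_pos hjk2]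
        · rw [if_pos (Nat.odd_iff.mp (Nat.not_even_iff_odd.mp hjk2)), if_neg hjk2]
    -- `evalE Q x = (‖x‖²)^{N/2} · class sum`
    have hterm : ∀ j ∈ K, ∀ k ∈ K,
        Zonal.evalE (if j + k ≤ N ∧ (j + k) % 2 = N % 2 then
            C ((j : ℝ) * (j + 1) - (k : ℝ) * (k + 1)) * (ρ ^ ((N - (j + k)) / 2) * Zonal.detP (P j) (P k)) else 0) x
          = (‖x‖ ^ 2) ^ ((N : ℝ) / 2) * (if (j + k) % 2 = N % 2 then
            (((j : ℝ) * (j + 1) - (k : ℝ) * (k + 1)) * (‖x‖ ^ 2) ^ (-(j : ℝ) / 2) * (‖x‖ ^ 2) ^ (-(k : ℝ) / 2)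
              * ⟪x, cross (gradient (H j) x) (gradient (H k) x)⟫) else 0) := by
      intro j hj k hk
      by_cases hpar : (j + k) % 2 = N % 2
      · by_cases hle : j + k ≤ N
        · -- a surviving pair: `N − (j + k) = 2m`
          obtain ⟨m, hm⟩ : ∃ m, N = j + k + 2 * m := ⟨(N - (j + k)) / 2, by omega⟩
          have hm' : (N - (j + k)) / 2 = m := by omega
          rw [if_pos ⟨hle, hpar⟩, if_pos hpar, hm', hB j hj k hk x]
          have hw := rpow_weight_eq_pow hx hm
          have hρx : (eval fun i => x i) ρ = ‖x‖ ^ 2 := by rw [hρ, norm_sq_fin3]; simp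
          simp only [Zonal.evalE, map_mul, eval_C, map_pow]
          rw [hρx, ← hw]
          ring
        · -- a pair above `N`: its bracket vanishes
          rw [if_neg (fun h => hle h.1), if_pos hpar, hB j hj k hk x, habove j hj k hk (not_le.mp hle) hpar]
          simp [Zonal.evalE]
      · rw [if_neg (fun h => hpar h.2), if_neg hpar]
        simp [Zonal.evalE]
    have hQe : Zonal.evalE Q x = (‖x‖ ^ 2) ^ ((N : ℝ) / 2) * ∑ j ∈ K, ∑ k ∈ K, (if (j + k) % 2 = N % 2 then
        (((j : ℝ) * (j + 1) - (k : ℝ) * (k + 1)) * (‖x‖ ^ 2) ^ (-(j : ℝ) / 2) * (‖x‖ ^ 2) ^ (-(k : ℝ) / 2)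
          * ⟪x, cross (gradient (H j) x) (gradient (H k) x)⟫) else 0) := by
      rw [hQ, Finset.mul_sum]
      simp only [Zonal.evalE, map_sum]
      refine Finset.sum_congr rfl fun j hj => ?_
      rw [Finset.mul_sum]
      refine Finset.sum_congr rfl fun k hk => ?_
      have := hterm j hj k hk
      simp only [Zonal.evalE] at this
      exact this
    rw [hQe, hS, mul_zero]
  -- (2) hence `Q = 0` (a polynomial function vanishing off the origin vanishes)
  have hQ0 : Q = 0 := by
    apply Zonal.eq_zero_of_evalE_eq_zero
    have hcont : Continuous (Zonal.evalE Q) := (Zonal.contDiff_evalE Q).continuous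
    have hEq : Zonal.evalE Q = fun _ => (0 : ℝ) :=
      Continuous.ext_on (dense_compl_singleton (0 : E3)) hcont continuous_const fun x hx => hQx x hx
    intro y
    rw [hEq]
  -- (3) complexify and go to the null cone: only the pair `(j₀, k₀)` survives
  have hchart := congrArg (fun q => Zonal.chartT (map (algebraMap ℝ ℂ) q)) hQ0
  simp only [map_zero, Zonal.chartT_zero] at hchart
  rw [hQ, map_sum, Zonal.chartT_sum] at hchart
  simp only [map_sum, Zonal.chartT_sum] at hchart
  rw [← Finset.sum_product' K K (fun j k => Zonal.chartT (map (algebraMap ℝ ℂ)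
      (if j + k ≤ N ∧ (j + k) % 2 = N % 2 then C ((j : ℝ) * (j + 1) - (k : ℝ) * (k + 1)) * (ρ ^ ((N - (j + k)) / 2) * Zonal.detP (P j) (P k))
        else 0)))] at hchart
  rw [Finset.sum_eq_add_of_mem (j₀, k₀) (k₀, j₀) (Finset.mk_mem_product hj₀ hk₀) (Finset.mk_mem_product hk₀ hj₀)
      (by simp [Prod.ext_iff, hjk]) ?_] at hchart
  · -- the two surviving terms
    have hself : (j₀ + k₀ ≤ N ∧ (j₀ + k₀) % 2 = N % 2) := ⟨le_rfl, rfl⟩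
    have hself' : (k₀ + j₀ ≤ N ∧ (k₀ + j₀) % 2 = N % 2) := ⟨by omega, by rw [add_comm]⟩
    simp only [if_pos hself, if_pos hself', show (N - (j₀ + k₀)) / 2 = 0 by omega,
      show (N - (k₀ + j₀)) / 2 = 0 by omega, pow_zero, one_mul, map_mul, map_C, Zonal.chartT_mul, Zonal.chartT_C,
      Zonal.detP_antisymm (P j₀) (P k₀), map_neg, Zonal.chartT_neg] at hchart
    have hne : (algebraMap ℝ ℂ) ((j₀ : ℝ) * (j₀ + 1)) - (algebraMap ℝ ℂ) ((k₀ : ℝ) * (k₀ + 1)) ≠ 0 := by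
      rw [← map_sub, Ne, map_eq_zero_iff _ (algebraMap ℝ ℂ).injective]
      exact mul_succ_ne_of_ne hjk
    simp only [map_sub] at hchart
    have h2 : (Polynomial.C ((algebraMap ℝ ℂ) ((j₀ : ℝ) * (j₀ + 1))) - Polynomial.C ((algebraMap ℝ ℂ) ((k₀ : ℝ) * (k₀ + 1))))
        * (2 * Zonal.chartT (map (algebraMap ℝ ℂ) (Zonal.detP (P j₀) (P k₀)))) = 0 := by
      linear_combination hchart
    rw [← Polynomial.C_sub] at h2
    rcases mul_eq_zero.mp h2 with h | h
    · exact absurd (Polynomial.C_eq_zero.mp h) hne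
    · exact (mul_eq_zero.mp h).resolve_left two_ne_zero
  · -- every other pair contributes zero
    rintro ⟨j, k⟩ hjk' ⟨hne1, hne2⟩
    obtain ⟨hj, hk⟩ := Finset.mem_product.mp hjk'
    simp only at hj hk ⊢
    by_cases hcond : j + k ≤ N ∧ (j + k) % 2 = N % 2
    · rw [if_pos hcond]
      rcases hcond.1.lt_or_eq with hlt | heq
      · -- below `N`: a genuine power of `r²`
        have hm : 1 ≤ (N - (j + k)) / 2 := by omega
        rw [map_mul, map_mul, map_pow, Zonal.chartT_mul, hρ]
        simp only [map_add, map_pow, map_X]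
        rw [Zonal.chartT_normSq_pow_mul _ hm, mul_zero]
      · -- on the level `N`: the bracket itself vanishes
        have hD : Zonal.detP (P j) (P k) = 0 := by
          by_cases hjk2 : j = k
          · rw [hjk2, Zonal.detP_self']
          · exact hiso j hj k hk hjk2 heq.ge hcond.2 (fun h => hne1 (Prod.ext h.1 h.2)) (fun h => hne2 (Prod.ext h.1 h.2))
        rw [hD, mul_zero, mul_zero, map_zero, Zonal.chartT_zero]
    · rw [if_neg hcond, map_zero, Zonal.chartT_zero]


end FiniteTowerClass

end Summit.NavierStokesRegularity.NavierStokesRegularity.Theorems.PoloidalLiouville.HorizonTower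

end
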